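import Literature.NumberTheory.Automorphic.LocalOrbitalIntegral
import Literature.NumberTheory.Automorphic.LocalOrbitalMeasure
import Mathlib.MeasureTheory.Function.LocallyIntegrable
import HarnessLib

/-!
# The orbital integrand `y ↦ f(y γ y⁻¹)` on `G ⧸ G_γ`: the orbit map, compact support and INTEGRABILITY
(Deitmar–Echterhoff, *Principles of Harmonic Analysis* (2014), Lemma 9.3.3; Rogawski 1990 §4.9)

Topic `NumberTheory/Automorphic` (generic part in namespace `Literature.MeasureTheory.Group`, next to the tree's orbital
integrand ★ `descConj`; unitary-group dress in `Literature.NumberTheory.Automorphic.UnitaryGroup`).  THEOREMS ONLY (no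
definition, no instance, no named fact, no `sorry`).

The tree's orbital integrals (★ `orbitalIntegral γ f m = ∫_{G ⧸ C(γ)} f(y γ y⁻¹) dm`, `LocalOrbitalIntegral`, F0P3a-p07; measures from ★
`LocalOrbitalMeasure`, F0P3a-p02) carry INTEGRABILITY of the orbital integrand `descConj γ C _ f` as a hypothesis (e.g.
★ `orbitalIntegral_add`).  This file discharges it from topology:

* §1 the ORBIT MAP `descConj γ M _ id : G ⧸ M → G`, `y M ↦ y γ y⁻¹` (no new definition: it is ★ `descConj` at `id`): continuous
  (`continuous_descConj_id`), its range is the conjugacy orbit (`range_descConj_id`), and for `M = C(γ)` the full centraliser it is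
  INJECTIVE (`injective_descConj_id_centralizer`);
* §2 if the orbit map is a CLOSED EMBEDDING (hypothesis — it holds iff the orbit of `γ` is closed and the orbit map is a
  homeomorphism onto it; for semisimple `γ` in a reductive group over a local field this is the closedness of semisimple orbits, NOT
  proved here), then for every `f` with compact support the orbital integrand has compact support (`hasCompactSupport_descConj`,
  Mathlib `HasCompactSupport.comp_isClosedEmbedding` + ★ `descConj_eq_comp`), hence is INTEGRABLE against every measure finite on
  compacts (`integrable_descConj`) — in particular against the invariant Radon measures of ★ `LocalOrbitalMeasure`; criteria for the
  hypothesis: compact orbit space (`isClosedEmbedding_descConj_id_of_compactSpace`: elliptic∕compact case), closed orbit map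
  (`…_of_isClosedMap`), proper orbit map (`…_of_isProperMap`);
* §3 the dress for ★ `orbitalIntegral` and the local unitary groups: `integrable_descConj_centralizer` (the hypothesis of ★
  `orbitalIntegral_add` discharged for `f ∈ C_c(G)`), `orbitalIntegral_add_of_isClosedEmbedding`, and
  `UnitaryGroup.localOrbitalIntegral_add_of_isClosedEmbedding` on `U(H)(L⁺_v) = (cmDatum L N H).Local v` [Rogawski1990, §4.9].

## References
* A. Deitmar, S. Echterhoff, *Principles of Harmonic Analysis*, 2nd ed. (2014), Lemma 9.3.3 (orbital integrals of `C_c` functions)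
  [DeitmarEchterhoff2014].
* J. Rogawski, *Automorphic Representations of Unitary Groups in Three Variables* (1990), §4.9 p. 54 [Rogawski1990].
-/

noncomputable section

open MeasureTheory Measure Topology NumberField IsDedekindDomain

namespace Literature.MeasureTheory.Group

/-! ## §1 The orbit map `y M ↦ y γ y⁻¹` -/

section OrbitMap

variable {G : Type*} [Group G] (γ₀ : G) (M : Subgroup G) (hM : ∀ m ∈ M, m * γ₀ = γ₀ * m)

/-- The range of the orbit map `y M ↦ y γ₀ y⁻¹` is the conjugacy orbit of `γ₀`. [cite: DeitmarEchterhoff2014, Lemma 9.3.3] -/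
theorem range_descConj_id : Set.range (descConj γ₀ M hM id) = {g | ∃ y : G, y * γ₀ * y⁻¹ = g} := by
  ext g
  constructor
  · rintro ⟨y, rfl⟩
    induction y using QuotientGroup.induction_on with
    | H x => exact ⟨x, rfl⟩
  · rintro ⟨y, rfl⟩
    exact ⟨QuotientGroup.mk y, rfl⟩

/-- **The orbit map on `G ⧸ C(γ₀)` is injective**: `y γ₀ y⁻¹ = y' γ₀ y'⁻¹` iff `y⁻¹ y'` centralises `γ₀` (★ `inv_mul_commute_of_conj_eq`).
[cite: DeitmarEchterhoff2014, Lemma 9.3.3] -/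
theorem injective_descConj_id_centralizer :
    Function.Injective (descConj γ₀ (Subgroup.centralizer ({γ₀} : Set G))
      (fun _ hg => Subgroup.mem_centralizer_singleton_iff.1 hg) id) := by
  intro a b hab
  induction a using QuotientGroup.induction_on with
  | H x =>
    induction b using QuotientGroup.induction_on with
    | H y =>
      rw [descConj_mk, descConj_mk, id, id] at hab
      exact QuotientGroup.eq.2 (Subgroup.mem_centralizer_singleton_iff.2 (inv_mul_commute_of_conj_eq hab))

variable [TopologicalSpace G] [IsTopologicalGroup G]

/-- The orbit map `y M ↦ y γ₀ y⁻¹` is continuous (★ `continuous_descConj` at `id`). [cite: DeitmarEchterhoff2014, Lemma 9.3.3] -/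
theorem continuous_descConj_id : Continuous (descConj γ₀ M hM id) :=
  continuous_descConj γ₀ M hM continuous_id

/-! ## §2 Compact support and integrability of the orbital integrand under a closed-embedding orbit map -/

omit [IsTopologicalGroup G] in
/-- **Compact support of the orbital integrand**: if the orbit map `G ⧸ M → G` is a closed embedding and `f` has compact support, then
`y M ↦ f(y γ₀ y⁻¹)` has compact support (Mathlib `HasCompactSupport.comp_isClosedEmbedding`, ★ `descConj_eq_comp`).
[cite: DeitmarEchterhoff2014, Lemma 9.3.3] -/
theorem hasCompactSupport_descConj {α : Type*} [TopologicalSpace α] [Zero α] {f : G → α} (hf : HasCompactSupport f)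
    (he : IsClosedEmbedding (descConj γ₀ M hM id)) : HasCompactSupport (descConj γ₀ M hM f) := by
  rw [descConj_eq_comp]
  exact hf.comp_isClosedEmbedding he

/-- **Integrability of the orbital integrand**: under a closed-embedding orbit map, for `f` continuous with compact support the orbital
integrand `y M ↦ f(y γ₀ y⁻¹)` is integrable against EVERY measure on `G ⧸ M` finite on compact sets (so the orbital integral
`∫_{G ⧸ M} f(y γ₀ y⁻¹) dm` is an honest Bochner integral). [cite: DeitmarEchterhoff2014, Lemma 9.3.3] -/
theorem integrable_descConj {E : Type*} [NormedAddCommGroup E] [MeasurableSpace (G ⧸ M)] [BorelSpace (G ⧸ M)]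
    {f : G → E} (hfc : Continuous f) (hf : HasCompactSupport f) (he : IsClosedEmbedding (descConj γ₀ M hM id))
    (m : Measure (G ⧸ M)) [IsFiniteMeasureOnCompacts m] : Integrable (descConj γ₀ M hM f) m :=
  (continuous_descConj γ₀ M hM hfc).integrable_of_hasCompactSupport (hasCompactSupport_descConj γ₀ M hM hf he)

/-- **Criterion 1 — compact orbit space**: if `G ⧸ C(γ₀)` is compact and `G` is Hausdorff, the orbit map is a closed embedding (a
continuous injection from a compact space to a Hausdorff space). [cite: DeitmarEchterhoff2014, Lemma 9.3.3] -/
theorem isClosedEmbedding_descConj_id_of_compactSpace [T2Space G]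
    [CompactSpace (G ⧸ Subgroup.centralizer ({γ₀} : Set G))] :
    IsClosedEmbedding (descConj γ₀ (Subgroup.centralizer ({γ₀} : Set G))
      (fun _ hg => Subgroup.mem_centralizer_singleton_iff.1 hg) id) :=
  (continuous_descConj_id γ₀ _ _).isClosedEmbedding (injective_descConj_id_centralizer γ₀)

/-- **Criterion 2 — closed orbit map**: an injective continuous CLOSED orbit map is a closed embedding (the orbit of `γ₀` is closed and
the orbit map is a homeomorphism onto it). [cite: DeitmarEchterhoff2014, Lemma 9.3.3] -/
theorem isClosedEmbedding_descConj_id_of_isClosedMap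
    (h : IsClosedMap (descConj γ₀ (Subgroup.centralizer ({γ₀} : Set G))
      (fun _ hg => Subgroup.mem_centralizer_singleton_iff.1 hg) id)) :
    IsClosedEmbedding (descConj γ₀ (Subgroup.centralizer ({γ₀} : Set G))
      (fun _ hg => Subgroup.mem_centralizer_singleton_iff.1 hg) id) :=
  .of_continuous_injective_isClosedMap (continuous_descConj_id γ₀ _ _) (injective_descConj_id_centralizer γ₀) h

/-- **Criterion 3 — proper orbit map**: a PROPER orbit map is a closed embedding (proper maps are closed). [cite: DeitmarEchterhoff2014, Lemma 9.3.3] -/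
theorem isClosedEmbedding_descConj_id_of_isProperMap
    (h : IsProperMap (descConj γ₀ (Subgroup.centralizer ({γ₀} : Set G))
      (fun _ hg => Subgroup.mem_centralizer_singleton_iff.1 hg) id)) :
    IsClosedEmbedding (descConj γ₀ (Subgroup.centralizer ({γ₀} : Set G))
      (fun _ hg => Subgroup.mem_centralizer_singleton_iff.1 hg) id) :=
  isClosedEmbedding_descConj_id_of_isClosedMap γ₀ h.isClosedMap

end OrbitMap

end Literature.MeasureTheory.Group

namespace Literature.NumberTheory.Automorphic

open Literature.MeasureTheory.Group

/-! ## §3 The dress for `orbitalIntegral` and for the local unitary groups -/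

section Orbital

variable {G : Type*} [Group G] [TopologicalSpace G] [IsTopologicalGroup G]
  {E : Type*} [NormedAddCommGroup E] [NormedSpace ℝ E]
  (γ : G) [MeasurableSpace (G ⧸ Subgroup.centralizer ({γ} : Set G))] [BorelSpace (G ⧸ Subgroup.centralizer ({γ} : Set G))]
  (m : Measure (G ⧸ Subgroup.centralizer ({γ} : Set G))) [IsFiniteMeasureOnCompacts m]

omit [NormedSpace ℝ E] in
/-- **The integrability hypothesis of ★ `orbitalIntegral_add` discharged**: under a closed-embedding orbit map, the orbital integrand of
every `f ∈ C_c(G, E)` is integrable against every measure on `G ⧸ C(γ)` finite on compacts. [cite: DeitmarEchterhoff2014, Lemma 9.3.3] -/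
theorem integrable_descConj_centralizer
    (he : IsClosedEmbedding (descConj γ (Subgroup.centralizer ({γ} : Set G))
      (fun _ hg => Subgroup.mem_centralizer_singleton_iff.1 hg) id))
    {f : G → E} (hfc : Continuous f) (hf : HasCompactSupport f) :
    Integrable (descConj γ (Subgroup.centralizer ({γ} : Set G)) (fun _ hg => Subgroup.mem_centralizer_singleton_iff.1 hg) f) m :=
  integrable_descConj γ _ _ hfc hf he m

/-- **Additivity of the orbital integral on `C_c(G)`** without integrability hypotheses, under a closed-embedding orbit map (★
`orbitalIntegral_add` + `integrable_descConj_centralizer`). [cite: Rogawski1990, §4.9 p. 54] -/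
theorem orbitalIntegral_add_of_isClosedEmbedding
    (he : IsClosedEmbedding (descConj γ (Subgroup.centralizer ({γ} : Set G))
      (fun _ hg => Subgroup.mem_centralizer_singleton_iff.1 hg) id))
    {f g : G → E} (hfc : Continuous f) (hf : HasCompactSupport f) (hgc : Continuous g) (hg : HasCompactSupport g) :
    orbitalIntegral γ (f + g) m = orbitalIntegral γ f m + orbitalIntegral γ g m :=
  orbitalIntegral_add γ m (integrable_descConj_centralizer γ m he hfc hf) (integrable_descConj_centralizer γ m he hgc hg)

end Orbital

namespace UnitaryGroup

section CM

variable (L : Type) [Field L] [NumberField L] [IsCMField L] (N : ℕ) (H : Matrix (Fin N) (Fin N) L)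
  (v : HeightOneSpectrum (𝓞 ↥(maximalRealSubfield L))) (γ : (cmDatum L N H).Local v)
  [MeasurableSpace ((cmDatum L N H).Local v ⧸ Subgroup.centralizer ({γ} : Set ((cmDatum L N H).Local v)))]
  [BorelSpace ((cmDatum L N H).Local v ⧸ Subgroup.centralizer ({γ} : Set ((cmDatum L N H).Local v)))]
  (m : Measure ((cmDatum L N H).Local v ⧸ Subgroup.centralizer ({γ} : Set ((cmDatum L N H).Local v))))
  [IsFiniteMeasureOnCompacts m]

/-- **Local orbital integrands on `U(H)(L⁺_v)` are integrable** for `f_v ∈ C_c(U(H)(L⁺_v))` under a closed-embedding orbit map of `γ`,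
against every measure on `U(H)(L⁺_v) ⧸ G_γ` finite on compacts — e.g. the invariant Radon measures of ★ `exists_localOrbitalMeasure`
(regular, hence finite on compacts): `Φ(γ, f_v)` of [Rogawski1990, §4.9] is then an honest integral. [cite: Rogawski1990, §4.9 p. 54] -/
theorem integrable_descConj_local
    (he : IsClosedEmbedding (descConj γ (Subgroup.centralizer ({γ} : Set ((cmDatum L N H).Local v)))
      (fun _ hg => Subgroup.mem_centralizer_singleton_iff.1 hg) id))
    {f : (cmDatum L N H).Local v → ℂ} (hfc : Continuous f) (hf : HasCompactSupport f) :
    Integrable (descConj γ (Subgroup.centralizer ({γ} : Set ((cmDatum L N H).Local v)))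
      (fun _ hg => Subgroup.mem_centralizer_singleton_iff.1 hg) f) m :=
  integrable_descConj_centralizer γ m he hfc hf

/-- `Φ(γ, f + g) = Φ(γ, f) + Φ(γ, g)` on `C_c(U(H)(L⁺_v))` under a closed-embedding orbit map (★ `localOrbitalIntegral_add` with its
integrability hypotheses discharged). [cite: Rogawski1990, §4.9 p. 54] -/
theorem localOrbitalIntegral_add_of_isClosedEmbedding
    (he : IsClosedEmbedding (descConj γ (Subgroup.centralizer ({γ} : Set ((cmDatum L N H).Local v)))
      (fun _ hg => Subgroup.mem_centralizer_singleton_iff.1 hg) id))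
    {f g : (cmDatum L N H).Local v → ℂ} (hfc : Continuous f) (hf : HasCompactSupport f) (hgc : Continuous g)
    (hg : HasCompactSupport g) :
    localOrbitalIntegral L N H v γ (f + g) m = localOrbitalIntegral L N H v γ f m + localOrbitalIntegral L N H v γ g m :=
  localOrbitalIntegral_add L N H v γ m (integrable_descConj_local L N H v γ m he hfc hf)
    (integrable_descConj_local L N H v γ m he hgc hg)

end CM

end UnitaryGroup

end Literature.NumberTheory.Automorphic

end
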